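/-
Copyright (c) 2026 the pub-hodgecm-mathlib formalisation cell (harness21).  Prover seat hodgecm-mathlib-F0P3b-p01 (g11), 2026-09-01.  Road «S3-tree» (architect A-p16 (g29)), brick T3′
«depth-zero κ-transfer», organ O8d-0 «LITERAL EIGENFRAMES» (DESIGN v2 §2 (P-1)): Flicker's four literal representatives are `P·diag·P⁻¹` with EXPLICIT `Φ₃`-orthogonal eigenframes
`h`, `D_π h` of Gram matrices `diag(−2, 1, 2)`, `diag(−2π, 1, 2π)` — the `hP`∕`τ = P·diag(γ)·P⁻¹` inputs of ★ O8a-3∕O8a-4 at the literals, and the parity vectors of O8a-∃.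
-/
import Literature.NumberTheory.Automorphic.UnitaryGroupFormTransport     -- ★ `formCongr σ T H = (σT)ᵀ H T`
import Mathlib.Tactic.LinearCombination
import HarnessLib

/-!
# Flicker's literals as conjugates of diagonal matrices by explicit `Φ₃`-orthogonal eigenframes

Topic `NumberTheory/Rogawski1990`; namespace `Literature.NumberTheory.Rogawski1990.Flicker1998`.  THEOREMS ONLY (no definition, no instance, no notation, no named fact, no `sorry`);
any commutative ring `R` with `2e = 1`, any ring endomorphism `σ` (fixing `π` where stated).  Cell `pub/hodgecm-mathlib`, crux H413 = `stmt-HodgeConjecture-24833`; road «S3-tree»,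
brick T3′, organ **O8d-0**: the eigenframe data of the four literals of ★ `finsum_finExplicitDelta_mul_classOrbitalIntegral_eq_of_split_of_values'`
(`t_1(x,y,z) = !![e(x+z),0,−e(x−z); 0,y,0; −e(x−z),0,e(x+z)]` and `t_π(x,y,z) = !![e(x+z),0,−e(x−z)π; 0,y,0; −e(x−z)π′,0,e(x+z)]`).  HONEST LABEL: HC_CM is proved only modulo the
cell's 2 remaining named inputs (hLiu418, h413) until rung 0 closes; matrix algebra, asserts nothing printed.

* §1 the frames: `h = !![1,0,1; 0,1,0; −1,0,1]`, `h′ = !![e,0,−e; 0,1,0; e,0,e]` (`h h′ = h′ h = 1`), `D_π h`, `h′ D_{π′}` (`π π′ = 1`);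
* §2 **`literal_one_eq_conj_diagonal`**: `t_1(x,y,z) = h · diagonal ![x,y,z] · h′`; **`literal_pi_eq_conj_diagonal`**: `t_π(x,y,z) = (D_π h) · diagonal ![x,y,z] · (h′ D_{π′})`;
* §3 the Gram matrices for `Φ₃ = antidiag(1,1,1)` (the adapter's `Matrix.of fun i j => if i.val + j.val + 1 = 3 then 1 else 0`): **`gram_flickerFrame`** `(σh)ᵀ Φ₃ h = diagonal ![−2, 1, 2]`,
  **`gram_flickerFrame_pi`** `(σ(D_π h))ᵀ Φ₃ (D_π h) = diagonal ![−2π, 1, 2π]` (`σ π = π`) — so the eigen-norm PARITY vectors are `(0,0,0)` for `t_1` and `(1,0,1)` (in frame order) for the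
  three `t_π`, i.e. base ∕ pp1 ∕ p1p ∕ 1pp in the `(a,d,u)` order of DESIGN v2 §2, with κ = (+,+,−,−) (★ FILE B).

## References
* [Flicker1998UnitaryFL] Y. Z. Flicker, *Elementary proof of the fundamental lemma for a unitary group*, Canad. J. Math. 50 (1998), §1 p. 76, Prop. 3 p. 78 (the frames `h`, the four representatives).
* [Rogawski1990] J. D. Rogawski, *Automorphic Representations of Unitary Groups in Three Variables* (1990), §4.9 p. 55.
-/

set_option autoImplicit false

open Matrix

namespace Literature.NumberTheory.Rogawski1990.Flicker1998

open Literature.NumberTheory.Automorphic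

variable {R : Type*} [CommRing R]

/-! ## §1 The frames -/

/-- `diagonal ![x,y,z]` as an explicit `3×3` matrix (for the `P·diagonal γ·P⁻¹` tokens of ★ O8a-3∕O8a-4). [cite: Flicker1998UnitaryFL, §1 p. 76] -/
theorem diagonal_fin_three (x y z : R) : diagonal ![x, y, z] = !![x, 0, 0; 0, y, 0; 0, 0, z] := by
  ext i j
  fin_cases i <;> fin_cases j <;> simp [diagonal]

/-- `h · h′ = 1` (`h′ = e·hᵀ`-type inverse, `2e = 1`). [cite: Flicker1998UnitaryFL, §1 p. 76] -/
theorem flickerFrame_mul_inv {e : R} (h2e : 2 * e = 1) :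
    !![(1 : R), 0, 1; 0, 1, 0; -1, 0, 1] * !![e, 0, -e; 0, 1, 0; e, 0, e] = 1 := by
  ext i j
  fin_cases i <;> fin_cases j <;> simp [Matrix.mul_apply, Fin.sum_univ_three] <;> linear_combination h2e

/-- `h′ · h = 1`. [cite: Flicker1998UnitaryFL, §1 p. 76] -/
theorem flickerFrameInv_mul {e : R} (h2e : 2 * e = 1) :
    !![e, 0, -e; 0, 1, 0; e, 0, e] * !![(1 : R), 0, 1; 0, 1, 0; -1, 0, 1] = 1 := by
  ext i j
  fin_cases i <;> fin_cases j <;> simp [Matrix.mul_apply, Fin.sum_univ_three] <;> linear_combination h2e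

/-- `(D_π h)(h′ D_{π′}) = 1` for `π π′ = 1`. [cite: Flicker1998UnitaryFL, Prop. 3 p. 78] -/
theorem flickerFramePi_mul_inv {e π π' : R} (h2e : 2 * e = 1) (hππ : π * π' = 1) :
    (!![π, 0, 0; 0, 1, 0; 0, 0, 1] * !![(1 : R), 0, 1; 0, 1, 0; -1, 0, 1]) * (!![e, 0, -e; 0, 1, 0; e, 0, e] * !![π', 0, 0; 0, 1, 0; 0, 0, 1]) = 1 := by
  ext i j
  fin_cases i <;> fin_cases j <;> simp [Matrix.mul_apply, Fin.sum_univ_three] <;>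
    first
    | linear_combination (π * π') * h2e + hππ
    | linear_combination (-(2 * e)) * hππ
    | linear_combination (2 * e) * hππ
    | linear_combination (-e) * hππ
    | linear_combination e * hππ
    | linear_combination (-e) * hππ - h2e
    | linear_combination e * hππ - h2e
    | linear_combination e * hππ + h2e
    | linear_combination (-e) * hππ + h2e
    | linear_combination h2e

/-- `(h′ D_{π′})(D_π h) = 1`. [cite: Flicker1998UnitaryFL, Prop. 3 p. 78] -/
theorem flickerFramePiInv_mul {e π π' : R} (h2e : 2 * e = 1) (hππ : π * π' = 1) :
    (!![e, 0, -e; 0, 1, 0; e, 0, e] * !![π', 0, 0; 0, 1, 0; 0, 0, 1]) * (!![π, 0, 0; 0, 1, 0; 0, 0, 1] * !![(1 : R), 0, 1; 0, 1, 0; -1, 0, 1]) = 1 := by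
  ext i j
  fin_cases i <;> fin_cases j <;> simp [Matrix.mul_apply, Fin.sum_univ_three] <;>
    first
    | linear_combination (π * π') * h2e + hππ
    | linear_combination (-(2 * e)) * hππ
    | linear_combination (2 * e) * hππ
    | linear_combination (-e) * hππ
    | linear_combination e * hππ
    | linear_combination (-e) * hππ - h2e
    | linear_combination e * hππ - h2e
    | linear_combination e * hππ + h2e

/-! ## §2 The literals are conjugates of diagonal matrices -/

/-- **`t_1(x,y,z) = h · diag(x,y,z) · h′`.** [cite: Flicker1998UnitaryFL, Prop. 3 p. 78] -/
theorem literal_one_eq_conj_diagonal (e x y z : R) :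
    !![e * (x + z), 0, -(e * (x - z)); 0, y, 0; -(e * (x - z)), 0, e * (x + z)] =
      !![(1 : R), 0, 1; 0, 1, 0; -1, 0, 1] * !![x, 0, 0; 0, y, 0; 0, 0, z] * !![e, 0, -e; 0, 1, 0; e, 0, e] := by
  ext i j
  fin_cases i <;> fin_cases j <;> simp [Matrix.mul_apply, Fin.sum_univ_three] <;> ring

/-- **`t_π(x,y,z) = (D_π h) · diag(x,y,z) · (h′ D_{π′})`.** [cite: Flicker1998UnitaryFL, Prop. 3 p. 78] -/
theorem literal_pi_eq_conj_diagonal {e π π' : R} (hππ : π * π' = 1) (x y z : R) :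
    !![e * (x + z), 0, -(e * (x - z) * π); 0, y, 0; -(e * (x - z) * π'), 0, e * (x + z)] =
      (!![π, 0, 0; 0, 1, 0; 0, 0, 1] * !![(1 : R), 0, 1; 0, 1, 0; -1, 0, 1]) * !![x, 0, 0; 0, y, 0; 0, 0, z] * (!![e, 0, -e; 0, 1, 0; e, 0, e] * !![π', 0, 0; 0, 1, 0; 0, 0, 1]) := by
  ext i j
  fin_cases i <;> fin_cases j <;> simp [Matrix.mul_apply, Fin.sum_univ_three] <;>
    first
    | linear_combination (e * (x + z)) * hππ
    | linear_combination (-(e * (x + z))) * hππ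
    | linear_combination (-(2 * e * (x + z))) * hππ
    | linear_combination (2 * e * (x + z)) * hππ
    | linear_combination (e * (x - z)) * hππ
    | linear_combination (-(e * (x - z))) * hππ
    | linear_combination (2 * e * (x - z)) * hππ
    | linear_combination (-(2 * e * (x - z))) * hππ
    | ring

/-! ## §3 The Gram matrices of the frames for `Φ₃ = antidiag(1,1,1)` -/

/-- **`(σh)ᵀ Φ₃ h = diag(−2, 1, 2)`**: the eigenframe `h` of `t_1` is `Φ₃`-ORTHOGONAL with norms `(−2, 1, 2)` — all units away from `2`: the parity vector of `t_1` is `(0,0,0)`.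
[cite: Flicker1998UnitaryFL, §1 p. 76] -/
theorem gram_flickerFrame (σ : R →+* R) :
    ((!![(1 : R), 0, 1; 0, 1, 0; -1, 0, 1]).map σ)ᵀ * (Matrix.of fun i j : Fin 3 => if i.val + j.val + 1 = 3 then (1 : R) else 0) * !![(1 : R), 0, 1; 0, 1, 0; -1, 0, 1] =
      !![(-2 : R), 0, 0; 0, 1, 0; 0, 0, 2] := by
  ext i j
  fin_cases i <;> fin_cases j <;> simp [Matrix.mul_apply, Fin.sum_univ_three, Matrix.of_apply] <;> norm_num

/-- **`(σ(D_π h))ᵀ Φ₃ (D_π h) = diag(−2π, 1, 2π)`** (`σ π = π`): the eigenframe of the three `t_π` literals has norms `(−2π, 1, 2π)` — parity vector `(1,0,1)` in frame order when `π` has odd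
valuation. [cite: Flicker1998UnitaryFL, Prop. 3 p. 78] -/
theorem gram_flickerFrame_pi (σ : R →+* R) {π : R} (hσπ : σ π = π) :
    ((!![π, 0, 0; 0, 1, 0; 0, 0, 1] * !![(1 : R), 0, 1; 0, 1, 0; -1, 0, 1]).map σ)ᵀ * (Matrix.of fun i j : Fin 3 => if i.val + j.val + 1 = 3 then (1 : R) else 0) *
        (!![π, 0, 0; 0, 1, 0; 0, 0, 1] * !![(1 : R), 0, 1; 0, 1, 0; -1, 0, 1]) =
      !![-2 * π, 0, 0; 0, 1, 0; 0, 0, 2 * π] := by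
  ext i j
  fin_cases i <;> fin_cases j <;> simp [Matrix.mul_apply, Fin.sum_univ_three, Matrix.of_apply, hσπ] <;> ring

end Literature.NumberTheory.Rogawski1990.Flicker1998
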